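import Summits.QuantumFields.YangMills.Theses.VirialFluxGap
import Summits.QuantumFields.YangMills.Theorems.VirialFluxGapVirialIdentity
import HarnessLib

/-!
# `VirialFluxGap.VirialIdentity` BY NAME (item stmt-QuantumFields-24161)

The support item `VirialIdentity` (positivity and the coupling-derivative of the seam-sector weights, derivative = the `Φ_z`-inserted weight) is
wanted by the two DRAFT-by-design lines `VirialFluxGap` (g14-A) and `SwapVirialDeficit` (g14-B) of seat ym-idea-4; it was proved by its ledger
signature as ✓`Summit.QuantumFields.YangMills.Theorems.virialIdentity_proof` (module `VirialFluxGapVirialIdentity`) before the route files declared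
it.  The route file `VirialFluxGap` now carries the declaration (verbatim the signature), and this module states the item BY NAME (the sibling
`SwapVirialDeficit.VirialIdentity` is the same proposition, `virialIdentity_proof` proves it too).

HONEST FRAMING: bookkeeping; no crux / rung / summit is proved; the YM mass gap is NOT proved (width seat ym-line-sfw-p2-w3 g35, free hands).
-/

namespace Summit.QuantumFields.YangMills.Theorems

/-- **`VirialFluxGap.VirialIdentity` holds** (item stmt-QuantumFields-24161, BY NAME). [cite: MontvayMunster1994, (3.145)] -/
theorem virialFluxGap_virialIdentity_proof :
    Summit.QuantumFields.YangMills.Theses.VirialFluxGap.VirialIdentity :=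
  virialIdentity_proof

end Summit.QuantumFields.YangMills.Theorems
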